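import Summits.ResolutionOfSingularities.ResolutionOfSingularities.Theorems.JetCutPoint2
import HarnessLib

/-!
# JetCutClasses — decomp-res node «JetCut» (lens-2 g15 rev 5)

Content VERBATIM from the decomp-res lens-2 file `HOME/decomp-res-lens-2/g15/JetCut.lean` rev 5 (pin 9f53e5ca =
`parts/JetCut-rev5-9f53e5ca.lean`, 7 495 l;
HOME = run/shared/lean/pub/decomp-res; CRITIC-LEDGER rows 109 / 115 / 120 / 121 / 122 / 127 / 133 CLEARED; landing
order INBOX :231; the critic's
HYGIENE-landing.md h1–h11 applied — DOCSTRING-ONLY).  The lens's blocks RESTATED VERBATIM from lens-2 g12 / g13 /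
g14 (§R / §R13 / §R14) are DELETED:
they are the tree's `RelativeDeltaCut*` / `CurveLeafExit*` / `PinchCut*` modules (namespaces `RelativeDeltaCut`,
`CurveLeafExit`, `PinchCut`, opened;
the lens's `CurveLeafExitRestated.x` / `PinchCutRestated.x` are cited as `CurveLeafExit.x` / `PinchCut.x`, the three
pointwise engine edges of g12 as
`RelativeDeltaCut.x`).  Namespace `…Theorems.JetCut` (the lens's `Theses.JetCut` is gate-reserved), sub-namespaces
`Tame` / `Wide` / `Broad` / `Vast`
as in the lens; file split only (tree files ≤ 400 lines): sections, variables and every declaration exactly as in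
the lens, the long rev-0/1 prose
lives in HOME/decomp-res-lens-2/g15/NODE-g15.md §ARCHIVE-A (not in the tree).  Node files, in import order:
`JetCutJetKernels`, `JetCutPoint`, `JetCutClasses`, `JetCutKernels`, `JetCutTame`, `JetCutTameClasses`,
`JetCutTameKernels`, `JetCutLadder`, `JetCutWideClasses`, `JetCutWideKernels`, `JetCutMixed`, `JetCutBroadClasses`,
`JetCutBroadKernels`, `JetCutDegenerate`, `JetCutVastClasses`, `JetCutVastKernels`
(each possibly continued `…2`, `…3`), then the wiring `MaxContactCutJetCut*` (in the Theses cone).  All `--supports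
stmt-ResolutionOfSingularities-29273`
(`MaxContactCut.RungOne`); nothing closes 29273 — decided cells carry their engines as hypotheses, and exactly ONE
located-residual aside is booked on
the route for this column (`Vast.VastSpecialRung`, home `JetCutVastClasses`).

§J4: the GRADED STATEMENTS of the jet cut in the fresh-data frame (binders of `WeakOrderReduction.SeqDimFour`):
`SeqJGen` (decided half, class letter), `SeqJSpec` (located), the ISO / NONISO / CURVE / TANGLE / REG / SING strata,
`JGenRungAt`, **`JetGenericRung`** / **`JetSpecialRung`**, and the in-Lean bed-row arithmetic — statement-only.

(Sources: HunekeSwanson2006 Cor. 5.5.5; CossartJannsenSaito2020 Ch. 2, Thm. 3.6/3.7, Ch. 8; CossartPiltant2008 Prop.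
4.2; CossartPiltant2019 Rem. 3.2; Hironaka1964 Ch. III; Hironaka1967; Hironaka1977; Moh1987; Giraud1975.)
-/

open CategoryTheory AlgebraicGeometry TopologicalSpace IsLocalRing
open Literature.AlgebraicGeometry.Resolution
open Summit.ResolutionOfSingularities.ResolutionOfSingularities.Theorems
open Summit.ResolutionOfSingularities.ResolutionOfSingularities.Theorems.WeakOrderReduction
open Summit.ResolutionOfSingularities.ResolutionOfSingularities.Theorems.DeltaFaceCutClasses
open Summit.ResolutionOfSingularities.ResolutionOfSingularities.Theorems.RelativeDeltaCut
open Summit.ResolutionOfSingularities.ResolutionOfSingularities.Theorems.CurveLeafExit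
open Summit.ResolutionOfSingularities.ResolutionOfSingularities.Theorems.PinchCut

namespace Summit.ResolutionOfSingularities.ResolutionOfSingularities.Theorems.JetCut

/-- **`SeqJSpec n`** — THE LOCATED CLASS: weak order reduction in dimension four at marking `n` for data having a
JET-SPECIAL core top point.  [UNDECIDED · IDEA-NEEDED · INSTRUMENTABLE T-jet / T-cone / T-uniform / T-round-bed.]
STATEMENT SCHEMA. (Sources: BierstoneGrigorievMilmanWlodarczyk2011 §3.1; CossartPiltant2019 Rem. 3.2; Moh1987.) -/
def SeqJSpec (n : ℕ) : Prop :=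
  ∀ p : ℕ, p.Prime → ∀ (k : Type) [Field k] [CharP k p]
    (Y : Scheme.{0}) (g : Y ⟶ Spec (.of k)), IsSeparated g → LocallyOfFiniteType g → QuasiCompact g →
    ∀ hY : Scheme.IsRegular Y, topologicalKrullDim Y ≤ 4 →
    ∀ I : Y.IdealSheafData, (∀ y : Y, idealOrder I y ≤ ((n : ℕ) : ℕ∞)) →
      (∃ y : Y, idealOrder I y = ((n : ℕ) : ℕ∞) ∧ IsJetSpecialPt g hY I n y) →
      ∃ t : CentreSeq Y, WeakResolution t (⟨I, [], n⟩ : MarkedIdeal Y)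

/-- `SeqJSpecNonIso n` — NON-ISOLATED column of the located class.  WEAKER BY LETTER than g14's `SeqPSpecNonIso n`.
[UNDECIDED · sub-cut `seqJSpecNonIso_iff`.] (Sources: CossartJannsenSaito2020 Ch. 5; CossartPiltant2019 Rem. 3.2.) -/
def SeqJSpecNonIso (n : ℕ) : Prop :=
  ∀ p : ℕ, p.Prime → ∀ (k : Type) [Field k] [CharP k p]
    (Y : Scheme.{0}) (g : Y ⟶ Spec (.of k)), IsSeparated g → LocallyOfFiniteType g → QuasiCompact g →
    ∀ hY : Scheme.IsRegular Y, topologicalKrullDim Y ≤ 4 →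
    ∀ I : Y.IdealSheafData, (∀ y : Y, idealOrder I y ≤ ((n : ℕ) : ℕ∞)) →
      (∃ y : Y, idealOrder I y = ((n : ℕ) : ℕ∞) ∧ IsJetSpecialPt g hY I n y ∧
        ¬ FaceFormCutClasses.IsIsolatedTop I n y) →
      ∃ t : CentreSeq Y, WeakResolution t (⟨I, [], n⟩ : MarkedIdeal Y)

/-- `SeqJSpecIso n` — ISOLATED column of the located class: jet-special core top points exist and every one of them is
isolated in the top locus (bed, in frame: the three binary towers; deep / power pinch near points after a section
package).  [UNDECIDED · INSTRUMENTABLE T-delta-tower.] (Sources: Hironaka1967; Moh1987.) -/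
def SeqJSpecIso (n : ℕ) : Prop :=
  ∀ p : ℕ, p.Prime → ∀ (k : Type) [Field k] [CharP k p]
    (Y : Scheme.{0}) (g : Y ⟶ Spec (.of k)), IsSeparated g → LocallyOfFiniteType g → QuasiCompact g →
    ∀ hY : Scheme.IsRegular Y, topologicalKrullDim Y ≤ 4 →
    ∀ I : Y.IdealSheafData, (∀ y : Y, idealOrder I y ≤ ((n : ℕ) : ℕ∞)) →
      (∃ y : Y, idealOrder I y = ((n : ℕ) : ℕ∞) ∧ IsJetSpecialPt g hY I n y) →
      (∀ y : Y, idealOrder I y = ((n : ℕ) : ℕ∞) → IsJetSpecialPt g hY I n y →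
        FaceFormCutClasses.IsIsolatedTop I n y) →
      ∃ t : CentreSeq Y, WeakResolution t (⟨I, [], n⟩ : MarkedIdeal Y)

/-- `SeqJSpecCurve n` — CURVE stratum of the non-isolated column AFTER the jet leaf left: some non-isolated jet-special
core top point lies on a clean curve.  WEAKER BY LETTER than g14's `SeqPSpecCurve n`.  [UNDECIDED · sub-cut
REGULAR/SINGULAR centre `seqJSpecCurve_iff_reg` · INSTRUMENTABLE T-jet / T-cone / T-uniform.] (Sources:
CossartJannsenSaito2020 Ch. 8–9; Narasimhan1983; CossartPiltant2008 Prop. 4.2.) -/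
def SeqJSpecCurve (n : ℕ) : Prop :=
  ∀ p : ℕ, p.Prime → ∀ (k : Type) [Field k] [CharP k p]
    (Y : Scheme.{0}) (g : Y ⟶ Spec (.of k)), IsSeparated g → LocallyOfFiniteType g → QuasiCompact g →
    ∀ hY : Scheme.IsRegular Y, topologicalKrullDim Y ≤ 4 →
    ∀ I : Y.IdealSheafData, (∀ y : Y, idealOrder I y ≤ ((n : ℕ) : ℕ∞)) →
      (∃ y : Y, idealOrder I y = ((n : ℕ) : ℕ∞) ∧ IsJetSpecialPt g hY I n y ∧
        ¬ FaceFormCutClasses.IsIsolatedTop I n y ∧ OnCleanCurve I n y) →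
      ∃ t : CentreSeq Y, WeakResolution t (⟨I, [], n⟩ : MarkedIdeal Y)

/-- `SeqJSpecTangle n` — TANGLE stratum of the non-isolated column (Round material BY NAME 30458/30459/30460).
[UNDECIDED · INSTRUMENTABLE T-round-bed.] (Sources: CossartJannsenSaito2020 Ch. 5; CossartPiltant2019 Rem. 3.2.) -/
def SeqJSpecTangle (n : ℕ) : Prop :=
  ∀ p : ℕ, p.Prime → ∀ (k : Type) [Field k] [CharP k p]
    (Y : Scheme.{0}) (g : Y ⟶ Spec (.of k)), IsSeparated g → LocallyOfFiniteType g → QuasiCompact g →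
    ∀ hY : Scheme.IsRegular Y, topologicalKrullDim Y ≤ 4 →
    ∀ I : Y.IdealSheafData, (∀ y : Y, idealOrder I y ≤ ((n : ℕ) : ℕ∞)) →
      (∃ y : Y, idealOrder I y = ((n : ℕ) : ℕ∞) ∧ IsJetSpecialPt g hY I n y ∧
        ¬ FaceFormCutClasses.IsIsolatedTop I n y) →
      (∀ y : Y, idealOrder I y = ((n : ℕ) : ℕ∞) → IsJetSpecialPt g hY I n y →
        ¬ FaceFormCutClasses.IsIsolatedTop I n y → ¬ OnCleanCurve I n y) →
      ∃ t : CentreSeq Y, WeakResolution t (⟨I, [], n⟩ : MarkedIdeal Y)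

/-- `SeqJSpecCurveReg n` — REGULAR-CENTRE sub-stratum of the curve stratum = THE CELL g14 LOCATED (`SeqPSpecCurveReg`)
CUT BY THE JET LEAF: some non-isolated jet-special core top point lies on a clean curve REGULAR at it.  What is LEFT
here: Top-isolated regular clean curves over SOME closed point of which a NEAR POINT OF ORDER `n` SURVIVES the blow-up
of the curve — deep tails / second-order cones (`z² + v(u₁+u₂)² + u₁⁵`: the near point `z'² + vw² + u₁³` is cone-shallow
one dimension up, a LENGTH-2 package), deep / power pinches (`zⁿ + vᵏuᵐ`, `k + r > n` or `k ≥ n`), non-monomial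
uniformly δ-special faces of slope `> 1`, mixed curves whose class-≥-2 points keep a near point; and curves failing
uniformity / Top-isolation.  [UNDECIDED · IDEA-NEEDED (iterated jet packages: the near-point locus over `C` is finite
over `C` — blow it up again; deep pinch = ISO material after the package) · INSTRUMENTABLE T-jet.] (Sources:
CossartJannsenSaito2020 Ch. 2, Ch. 8–9; CossartPiltant2008 Prop. 4.2; Hironaka1967.) -/
def SeqJSpecCurveReg (n : ℕ) : Prop :=
  ∀ p : ℕ, p.Prime → ∀ (k : Type) [Field k] [CharP k p]
    (Y : Scheme.{0}) (g : Y ⟶ Spec (.of k)), IsSeparated g → LocallyOfFiniteType g → QuasiCompact g →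
    ∀ hY : Scheme.IsRegular Y, topologicalKrullDim Y ≤ 4 →
    ∀ I : Y.IdealSheafData, (∀ y : Y, idealOrder I y ≤ ((n : ℕ) : ℕ∞)) →
      (∃ y : Y, idealOrder I y = ((n : ℕ) : ℕ∞) ∧ IsJetSpecialPt g hY I n y ∧
        ¬ FaceFormCutClasses.IsIsolatedTop I n y ∧ OnRegularCleanCurve I n y) →
      ∃ t : CentreSeq Y, WeakResolution t (⟨I, [], n⟩ : MarkedIdeal Y)

/-- `SeqJSpecCurveSing n` — SINGULAR-CENTRE sub-stratum (g14's, with jet-special points): non-isolated jet-special core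
top points on clean curves exist and NONE of them lies on a clean curve regular at it (`HauserE7`: the cusp `(t², t³)`;
`Narasimhan`: `(t³², t⁷, t¹⁹, t¹⁵)`).  [UNDECIDED · INSTRUMENTED (T-singular-followup) · Round / TANGLE material after
rounds.] (Sources: Narasimhan1983; Hauser2010; CossartJannsenSaito2020 Ch. 5.) -/
def SeqJSpecCurveSing (n : ℕ) : Prop :=
  ∀ p : ℕ, p.Prime → ∀ (k : Type) [Field k] [CharP k p]
    (Y : Scheme.{0}) (g : Y ⟶ Spec (.of k)), IsSeparated g → LocallyOfFiniteType g → QuasiCompact g →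
    ∀ hY : Scheme.IsRegular Y, topologicalKrullDim Y ≤ 4 →
    ∀ I : Y.IdealSheafData, (∀ y : Y, idealOrder I y ≤ ((n : ℕ) : ℕ∞)) →
      (∃ y : Y, idealOrder I y = ((n : ℕ) : ℕ∞) ∧ IsJetSpecialPt g hY I n y ∧
        ¬ FaceFormCutClasses.IsIsolatedTop I n y ∧ OnCleanCurve I n y) →
      (∀ y : Y, idealOrder I y = ((n : ℕ) : ℕ∞) → IsJetSpecialPt g hY I n y →
        ¬ FaceFormCutClasses.IsIsolatedTop I n y → OnCleanCurve I n y → ¬ OnRegularCleanCurve I n y) →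
      ∃ t : CentreSeq Y, WeakResolution t (⟨I, [], n⟩ : MarkedIdeal Y)

/-- `JGenRungAt n` — the decided rung at one marking: `SeqDimFour 2 n → SeqJGen n`.  [DECIDED-MOD-PORT, `n ≥ 2`:
`jGenRungAt_of_engines`; `n = 1`: `jGenRungAt_one`.] -/
def JGenRungAt (n : ℕ) : Prop := SeqDimFour 2 n → SeqJGen n

/-- **`JetGenericRung`** — the DECIDED half of `RungOne`: `E 2 →` weak order reduction for every marking and all data
whose core top points are near-generic, δ-generic, curve-generic, rel-curve-generic, flat-curve, pinch-curve, cone-curve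
or jet-curve points.  [WEAKER · DECIDED-MOD-PORT(M+): `jetGenericRung_of_engines`.]  STATEMENT (decided piece).
(Sources: CossartPiltant2008 Prop. 4.2; Hironaka1967; CossartJannsenSaito2020 Ch. 2, Ch. 8.) -/
def JetGenericRung : Prop := E 2 → ∀ n : ℕ, 1 ≤ n → SeqJGen n

/-- **`JetSpecialRung`** — THE LOCATED RESIDUAL of this node: `E 2 →` weak order reduction for every marking and all
data with a jet-special core top point.  [WEAKER BY LETTER · UNDECIDED · IDEA-NEEDED · cofinal ⇒ score 0.]
STATEMENT (located residual). (Sources: CossartPiltant2019 Rem. 3.2; Moh1987; Giraud1975; Narasimhan1983.) -/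
def JetSpecialRung : Prop := E 2 → ∀ n : ℕ, 1 ≤ n → SeqJSpec n

/-! ### Arithmetic of the new bed rows (in-Lean sanity of the one-step order bookkeeping) -/

example : 3 - 2 = 1 ∧ 1 < 2 := by decide            -- conetail:2 z²+v(u₁+u₂)²+u₁³: tail layer n+1 = 3, u₁-chart order 1 < 2

example : ¬ (5 - 2 < 2) ∧ 5 - 2 = 3 := by decide     -- deeptail:2 …+u₁⁵: u₁-chart z'²+vw²+u₁³ keeps order 2 at θ = (1:1)

example : 4 - 3 < 3 ∧ 5 - 3 < 3 ∧ ¬ (7 - 3 < 3) := by decide   -- n = 3, p = 3: tails u₁⁴, u₁⁵ exit; u₁⁷ persists (u₁⁶ excluded: (z+u₁²)³)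

end Summit.ResolutionOfSingularities.ResolutionOfSingularities.Theorems.JetCut
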